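import Summits.QuantumFields.YangMills.Theorems.MirrorModularBoostsSoftKernelBoostCovarianceAsmGeometryMargins
import Summits.QuantumFields.YangMills.Theorems.MirrorModularBoostsSoftKernelBoostCovarianceAsmGeometryRot
import Summits.QuantumFields.YangMills.Theorems.MirrorModularBoostsSoftKernelBoostCovarianceAsmSuperpositionTools
import Summits.QuantumFields.YangMills.Theorems.MirrorModularBoostsSoftKernelBoostCovarianceAsmConstantsAndBumps
import Summits.QuantumFields.YangMills.Theorems.MirrorModularBoostsSoftKernelBoostCovarianceSlotProductExpansionJoint
import Summits.QuantumFields.YangMills.Theorems.MirrorModularBoostsSoftKernelBoostCovarianceRadialRiemann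
import Summits.QuantumFields.YangMills.Theorems.MirrorModularBoostsSoftKernelBoostCovarianceAsmHeightsVitali
import Summits.QuantumFields.YangMills.Theorems.MirrorModularBoostsSoftKernelBoostCovarianceAsmTermChainFree
import Summits.QuantumFields.YangMills.Theorems.MirrorModularBoostsSoftKernelBoostCovarianceAsmUniformBoost
import Summits.QuantumFields.YangMills.Theorems.MirrorModularBoostsCurvatureBoostCovarianceOrbitAllAngles

/-!
# Assembly piece (Uii) — sub-threshold type from lower-level planar invariance

Line `Sketch` of crux `MirrorModularBoosts.SoftKernelBoostCovariance` (stmt-QuantumFields-14999): part (ii) of the lead's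
assembly (T7) of the registered skeleton `Cruxes/SoftKernelBoostCovariance/Lines/Sketch.lean` (v3.5); conclusion (ii) of
the registered `stub_chainBoostVectors` (T*) under its hypotheses and `0 ≤ μ`: at a level `a ≥ 1` at which `S₁` is planar
invariant on `⁰𝒮` in all degrees `≤ 2a − 2`, the field vectors `Ψ_{R_θ F}` of every compactly supported time-ordered `F` of
degree `a` are the real values of a family of exponential type EXACTLY `μ` (the sandwich exponent) — only ONE insertion is paid.

**Proof.**  As (Ui) (`…AsmUniformBoost.lean`) at `a = m + 1`, with the landed (A3) `stub_asmTermChainFree` in place of (G)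
for every term: planar invariance in degree `m + m ≤ 2a − 2` is the level hypothesis (`planeRot 0 θ` has determinant one and
fixes `e₂, e₃`: `OrbitBandlimit.det_planeRot`, `planeRot_single_two/three`); per-height bound
`max M 0 · max K_{u_m} 0 · K_{δ/16}^m ‖Ψ_1‖ ≤ K e^{μ m}` (`sandwichConst_le_type`); the landed (A1) `stub_asmHeightsVitali` with
`N = μ`.

References: J. Glimm, A. Jaffe, *Quantum Physics* (2nd ed. 1987), §19.5–19.7; K. Osterwalder, R. Schrader, CMP 42 (1975) §V.
-/

noncomputable section

namespace Summit.QuantumFields.YangMills.Theorems.SoftKernelBoostCovariance.Sketch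

open scoped BigOperators SchwartzMap InnerProductSpace
open MeasureTheory Filter Topology
open Literature.MathematicalPhysics.QuantumLattice Literature.MathematicalPhysics.AQFT
  Literature.MathematicalPhysics.QuantumFieldTheory
open Summit.QuantumFields.YangMills.Theorems.NPointIsotropy.Negative (E4)
open Summit.QuantumFields.YangMills.Theorems.CurvatureBoostCovariance.Negative
  (OSPackage Translations Hypercubic EightFrameRP PlanarCone PlanarInvariant)
open Summit.QuantumFields.YangMills.Cruxes.PlanarSpectralCone.PositivityDiscToOperatorCone.Density
  (isTimeOrdered_add fieldVec_add fieldVec_smul fieldVec_congr fieldVec_zero tendsto_fieldVec)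
open Summit.QuantumFields.YangMills.Theorems.CurvatureBoostCovariance.BoostsInheritMirrors (OrbitBandlimit.det_planeRot
  OrbitBandlimit.planeRot_single_two OrbitBandlimit.planeRot_single_three)

/-- **Stub (Uii) — SUB-THRESHOLD TYPE FROM LOWER-LEVEL PLANAR INVARIANCE** (conclusion (ii) of (T*) under (T*)'s
hypotheses and `0 ≤ μ`). -/
theorem stub_asmTypedBoost :
    open Literature.MathematicalPhysics.QuantumLattice Literature.MathematicalPhysics.AQFT
      Literature.MathematicalPhysics.QuantumFieldTheory
      Summit.QuantumFields.YangMills.Theorems.CurvatureBoostCovariance.Negative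
      Summit.QuantumFields.YangMills.Theorems.NPointIsotropy.Negative in
    ∀ (S₁ : SchwingerFamily E4) (h : OSReconstructionNoE1 S₁.toLabelled),
      S₁.toLabelled.HasLinearGrowth → S₁.toLabelled.IsSymmetric → Translations S₁ → EightFrameRP S₁ → PlanarCone S₁ →
      (∃ N : ℂ × ℂ → (h.Hilbert →L[ℂ] h.Hilbert),
          (∀ p : ℂ × ℂ, |p.2.im| < p.1.re → ‖N p‖ ≤ 1) ∧
          (∀ ψ ψ' : h.Hilbert, DifferentiableOn ℂ (fun p : ℂ × ℂ => ⟪ψ, N p ψ'⟫_ℂ) {p : ℂ × ℂ | |p.2.im| < p.1.re}) ∧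
          (∀ (t b : ℝ), 0 < t → ∀ ψ : h.Hilbert,
            N ((t : ℂ), (b : ℂ)) ψ = h.transfer t (h.translate (b • EuclideanSpace.single 1 1) ψ))) →
      ∀ (μ C : ℝ),
        (∀ (u v : ℝ), 0 < u → 0 < v → u ≤ 1 → v ≤ 1 →
           ∀ (f₁ : SchwartzMap (Fin 1 → E4) ℂ) (g hh : ℝ × ℝ → ℂ) (Mg Mh Mh' : ℝ),
             (∀ x : Fin 1 → E4, f₁ x = g (x 0 0, x 0 1) * hh (x 0 2, x 0 3)) →
             (∀ p : ℝ × ℝ, g p ≠ 0 → u ≤ p.1 ∧ p.1 ≤ 2 * u) →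
             MeasureTheory.Integrable g → (∫ p, ‖g p‖) ≤ Mg →
             MeasureTheory.Integrable hh → (∫ p, ‖hh p‖) ≤ Mh → (∀ p, ‖hh p‖ ≤ Mh') →
           ∀ (n : ℕ) (W : SchwartzMap (Fin n → E4) ℂ) (hW : IsTimeOrdered W)
             (hFW : IsTimeOrdered
               (SchwartzMap.appendTensor f₁ (translateMulti ((2 * u + v) • EuclideanSpace.single 0 1) W))),
             ‖h.fieldVec (1 + n) (fun _ => ())
                 (SchwartzMap.appendTensor f₁ (translateMulti ((2 * u + v) • EuclideanSpace.single 0 1) W)) hFW‖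
               ≤ C * Mg * (Mh + Mh') * (u ^ (-μ) + v ^ (-μ)) * ‖h.fieldVec n (fun _ => ()) W hW‖) →
        0 ≤ μ →
        (∀ a : ℕ, 1 ≤ a →
          (∀ N : ℕ, N + 2 ≤ 2 * a → ∀ R : E4 ≃ₗᵢ[ℝ] E4,
            LinearMap.det (R.toLinearEquiv : E4 →ₗ[ℝ] E4) = 1 →
            R (EuclideanSpace.single 2 1) = EuclideanSpace.single 2 1 →
            R (EuclideanSpace.single 3 1) = EuclideanSpace.single 3 1 →
            ∀ F : SchwartzMap (Fin N → E4) ℂ, IsOffDiagonal F → S₁ N (linActMulti R F) = S₁ N F) →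
          ∀ (F : SchwartzMap (Fin a → E4) ℂ), IsTimeOrdered F → HasCompactSupport (F : (Fin a → E4) → ℂ) →
            ∃ ε : ℝ, 0 < ε ∧ ∃ (V : ℂ → h.Hilbert) (C' : ℝ),
              DifferentiableOn ℂ V {θ : ℂ | |θ.re| < ε} ∧
              (∀ θ : ℂ, |θ.re| < ε → ‖V θ‖ ≤ C' * Real.exp (μ * |θ.im|)) ∧
              ∀ θ : ℝ, |θ| < ε → ∀ hθ : IsTimeOrdered (linActMulti (planeRot (0 : Fin 3) θ) F),
                V θ = h.fieldVec a (fun _ => ()) (linActMulti (planeRot (0 : Fin 3) θ) F) hθ) := by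
  intro S₁ h _hlg _hsym htr _h8 _hC hN μ C hS hμ a ha hInv F hF hFc
  obtain ⟨N, hN1, hN2, hN3⟩ := hN
  obtain ⟨m, rfl⟩ : ∃ m : ℕ, a = m + 1 := ⟨a - 1, by omega⟩
  -- planar invariance in the doubled tail degree `m + m ≤ 2a - 2`
  have hInv' : ∀ (θ : ℝ) (F' : 𝓢((Fin (m + m) → E4), ℂ)), IsOffDiagonal F' →
      S₁ (m + m) (linActMulti (planeRot (0 : Fin 3) θ) F') = S₁ (m + m) F' := fun θ F' hF' =>
    hInv (m + m) (by omega) (planeRot (0 : Fin 3) θ) (OrbitBandlimit.det_planeRot θ)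
      (OrbitBandlimit.planeRot_single_two θ) (OrbitBandlimit.planeRot_single_three θ) F' hF'
  -- Step 1: geometry of `F`
  obtain ⟨δ, L, hδ, hδ1, hL, hK⟩ := geom_margins F hF hFc
  set ε : ℝ := δ / (4 * L) with hε_def
  have hL0 : 0 < L := by linarith
  have hε : 0 < ε := by positivity
  have hrotF : ∀ θ : ℝ, |θ| < ε → IsTimeOrdered (linActMulti (planeRot (0 : Fin 3) θ) F) :=
    fun θ hθ => isTimeOrdered_rot_of_margins hδ hδ1 hL hK hθ
  -- Step 2: the bump-tensor approximants (T4a-joint with T4b), one per `k`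
  obtain ⟨A, M, hAM⟩ := stub_slotProductExpansionJoint stub_radialRiemann (m + 1) F hFc δ hδ
  have hstep : ∀ k : ℕ, ∃ (ρ : ℝ) (φ : ℝ → ℂ) (I : ℕ) (c : Fin I → Fin (m + 1) → ℝ × ℝ)
      (hh : Fin I → Fin (m + 1) → ℝ × ℝ → ℂ)
      (f0 : Fin I → Fin (m + 1) → 𝓢((Fin 1 → E4), ℂ)) (lam : Fin I → ℂ) (T : Fin I → 𝓢((Fin (m + 1) → E4), ℂ)),
      0 < ρ ∧ ρ ≤ Real.exp (-((k : ℝ) + 1)) * (δ / 32) ∧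
      (∀ r : ℝ, ρ ^ 2 < r → φ r = 0) ∧
      MeasureTheory.Integrable (fun p : ℝ × ℝ => φ (p.1 ^ 2 + p.2 ^ 2)) ∧
      (∫ p : ℝ × ℝ, ‖φ (p.1 ^ 2 + p.2 ^ 2)‖) ≤ 1 ∧
      (∀ (i : Fin I) (j : Fin (m + 1)) (x : Fin 1 → E4),
        f0 i j x = φ ((x 0 0) ^ 2 + (x 0 1) ^ 2) * hh i j (x 0 2, x 0 3)) ∧
      (∀ (i : Fin I) (x : Fin (m + 1) → E4),
        T i x = ∏ j, φ ((x j 0 - (c i j).1) ^ 2 + (x j 1 - (c i j).2) ^ 2) * hh i j (x j 2, x j 3)) ∧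
      (∀ i : Fin I, ∃ x ∈ tsupport (F : (Fin (m + 1) → E4) → ℂ), ∀ j : Fin (m + 1),
        |(c i j).1 - x j 0| ≤ δ ∧ |(c i j).2 - x j 1| ≤ δ) ∧
      (∀ (i : Fin I) (j : Fin (m + 1)), MeasureTheory.Integrable (hh i j) ∧
        (∫ p : ℝ × ℝ, ‖hh i j p‖) ≤ A ∧ ∀ p : ℝ × ℝ, ‖hh i j p‖ ≤ A) ∧
      (∑ i, ‖lam i‖ ≤ M) ∧
      (∀ p q : ℕ, p ≤ k → q ≤ k → SchwartzMap.seminorm ℝ p q (F - ∑ i, lam i • T i) < 1 / ((k : ℝ) + 1)) := by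
    intro k
    obtain ⟨ρ₀, hρ₀, hρ⟩ := hAM ((Finset.range (k + 1)) ×ˢ (Finset.range (k + 1))) (1 / ((k : ℝ) + 1))
      (by positivity)
    have hρpos : 0 < min ρ₀ (Real.exp (-((k : ℝ) + 1)) * (δ / 32)) := lt_min hρ₀ (by positivity)
    obtain ⟨φ, I, c, hh, f0, lam, T, hφ, hφi, hφ1, hf0, hT, hloc, hhh, hlam, herr⟩ :=
      hρ _ hρpos (min_le_left _ _)
    refine ⟨_, φ, I, c, hh, f0, lam, T, hρpos, min_le_right _ _, hφ, hφi, hφ1, hf0, hT, hloc, hhh, hlam,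
      fun p q hp hq => herr (p, q) ?_⟩
    exact Finset.mem_product.2 ⟨Finset.mem_range.2 (by omega), Finset.mem_range.2 (by omega)⟩
  choose ρ φ I c hh f0 lam T hρ hρle hφ hφi hφ1 hf0 hT hloc hhh hlam herr using hstep
  -- Step 3: rotated centres of every term (joint localisation)
  have hgeo : ∀ (k : ℕ) (i : Fin (I k)) (θ : ℝ), |θ| < ε →
      (∀ j : Fin (m + 1), δ ≤ Real.cos θ * (c k i j).1 + Real.sin θ * (c k i j).2) ∧
      (∀ i' j : Fin (m + 1), i' < j → δ / 2 ≤ (Real.cos θ * (c k i j).1 + Real.sin θ * (c k i j).2) -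
          (Real.cos θ * (c k i i').1 + Real.sin θ * (c k i i').2)) :=
    fun k i θ hθ => (centres_rot hδ hδ1 hL hK (hloc k i)).2 θ hθ
  -- Step 4: reserves `u m' = e^{-(m'+1)} δ/16` and the free-lower-block chains of every term at every height
  set u : ℕ → ℝ := fun m' => Real.exp (-((m' : ℝ) + 1)) * (δ / 16) with hu_def
  set Ψ1 : ℝ := ‖h.fieldVec 0 (fun _ => ()) (SchwartzMap.constOfSubsingleton 1)
      OSReconstructionNoE1.isTimeOrdered_constOfSubsingleton‖ with hΨ1_def
  set Kof : ℕ → ℝ := fun m' => max (C * 1 * (A + A) * ((u m') ^ (-μ) + (u m') ^ (-μ))) 0 with hKof_def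
  set Kfix : ℝ := max (C * 1 * (A + A) * ((δ / 16) ^ (-μ) + (δ / 16) ^ (-μ))) 0 with hKfix_def
  have hKfix0 : 0 ≤ Kfix := le_max_right _ _
  have hexp_mono : ∀ {m' k : ℕ}, m' ≤ k → Real.exp (-((k : ℝ) + 1)) ≤ Real.exp (-((m' : ℝ) + 1)) := by
    intro m' k hmk
    have hmk' : (m' : ℝ) ≤ k := by exact_mod_cast hmk
    exact Real.exp_le_exp.2 (by linarith)
  have hchain : ∀ (k : ℕ) (i : Fin (I k)) (m' : ℕ), m' ≤ k →
      (∀ θ : ℝ, |θ| < ε → IsTimeOrdered (linActMulti (planeRot (0 : Fin 3) θ) (T k i))) ∧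
      ∃ V : ℂ → h.Hilbert, DifferentiableOn ℂ V {ζ : ℂ | |ζ.re| < ε ∧ |ζ.im| < (m' : ℝ) + 1} ∧
        (∀ ζ : ℂ, |ζ.re| < ε → |ζ.im| < (m' : ℝ) + 1 → ‖V ζ‖ ≤ Kof m' * Kfix ^ m * Ψ1) ∧
        (∀ θ : ℝ, |θ| < ε → ∀ hθ : IsTimeOrdered (linActMulti (planeRot (0 : Fin 3) θ) (T k i)),
          V θ = h.fieldVec (m + 1) (fun _ => ()) (linActMulti (planeRot (0 : Fin 3) θ) (T k i)) hθ) := by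
    intro k i m' hmk
    have h2ρ : 2 * ρ k ≤ u m' := by
      have := hρle k
      have := hexp_mono hmk
      have hδ32 : 0 ≤ δ / 32 := by positivity
      calc 2 * ρ k ≤ 2 * (Real.exp (-((k : ℝ) + 1)) * (δ / 32)) := by linarith
        _ ≤ 2 * (Real.exp (-((m' : ℝ) + 1)) * (δ / 32)) := by gcongr
        _ = u m' := by rw [hu_def]; ring
    have hρ32 : ρ k ≤ δ / 32 := by
      have h1 : Real.exp (-((k : ℝ) + 1)) ≤ 1 := Real.exp_le_one_iff.2 (by linarith [(Nat.cast_nonneg k : (0 : ℝ) ≤ k)])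
      calc ρ k ≤ Real.exp (-((k : ℝ) + 1)) * (δ / 32) := hρle k
        _ ≤ 1 * (δ / 32) := mul_le_mul_of_nonneg_right h1 (by positivity)
        _ = δ / 32 := one_mul _
    have huR' : u m' * Real.exp ((m' : ℝ) + 1) = δ / 16 := by
      have : Real.exp (-((m' : ℝ) + 1)) * Real.exp ((m' : ℝ) + 1) = 1 := by
        rw [← Real.exp_add]; simp
      calc u m' * Real.exp ((m' : ℝ) + 1) = (Real.exp (-((m' : ℝ) + 1)) * Real.exp ((m' : ℝ) + 1)) * (δ / 16) := by
            rw [hu_def]; ring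
        _ = δ / 16 := by rw [this, one_mul]
    have huR : u m' * Real.exp ((m' : ℝ) + 1) ≤ δ / 16 := huR'.le
    obtain ⟨hTO, V, hVd, hVb, hVr⟩ := stub_asmTermChainFree S₁ h N hN1 hN2 hN3 htr μ C hS m δ ε (ρ k) (u m')
      ((m' : ℝ) + 1) A (φ k) (hh k i) (f0 k i) (c k i) (T k i) hδ hδ1 hε (hρ k) hρ32 (by positivity) h2ρ huR
      hInv' (hφ k) (hφi k) (hφ1 k) (hf0 k i) (hT k i) (hhh k i) (hgeo k i)
    exact ⟨hTO, V, hVd, hVb, hVr⟩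
  choose hTO Vt hVd hVb hVr using hchain
  -- Step 5: the approximants `F_k`, their rotations, superposition
  set Fk : ℕ → 𝓢((Fin (m + 1) → E4), ℂ) := fun k => ∑ i, lam k i • T k i with hFk_def
  have hrotFk : ∀ (k : ℕ) (θ : ℝ), |θ| < ε → IsTimeOrdered (linActMulti (planeRot (0 : Fin 3) θ) (Fk k)) := by
    intro k θ hθ
    rw [hFk_def, linActMulti_finset_sum_smul]
    exact isTimeOrdered_finset_sum _ _ _ fun i => hTO k i k le_rfl θ hθ
  set V : ℕ → ℕ → ℂ → h.Hilbert := fun k m' ζ =>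
    if hmk : m' ≤ k then ∑ i, lam k i • Vt k i m' hmk ζ else 0 with hV_def
  set g : ℕ → ℝ → h.Hilbert := fun k θ =>
    if hθ : |θ| < ε then h.fieldVec (m + 1) (fun _ => ()) (linActMulti (planeRot (0 : Fin 3) θ) (Fk k)) (hrotFk k θ hθ)
    else 0 with hg_def
  set g' : ℝ → h.Hilbert := fun θ =>
    if hθ : |θ| < ε then h.fieldVec (m + 1) (fun _ => ()) (linActMulti (planeRot (0 : Fin 3) θ) F) (hrotF θ hθ)
    else 0 with hg'_def
  -- Step 6: the constants (ONE height-dependent insertion: type `μ`)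
  have hM0 : 0 ≤ max M 0 := le_max_right _ _
  set K : ℝ := max M 0 * ((4 * |C| * |A| * (δ / 16) ^ (-μ) * Real.exp |μ|) * Kfix ^ m * Ψ1) with hK_def
  have hKof_le : ∀ m' : ℕ, Kof m' ≤ (4 * |C| * |A| * (δ / 16) ^ (-μ) * Real.exp |μ|) * Real.exp (μ * m') := by
    intro m'
    have := sandwichConst_le_type (C := C) (A := A) (μ := μ) (u₁ := δ / 16) (by positivity)
      (m' := (m' : ℝ) + 1) (y := (m' : ℝ)) le_rfl (by linarith)
    simpa [hKof_def, hu_def] using this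
  have hK0 : 0 ≤ K := by positivity
  -- Step 7: hypotheses of (A1)
  have hdiff : ∀ k m' : ℕ, m' ≤ k → DifferentiableOn ℂ (V k m') {ζ : ℂ | |ζ.re| < ε ∧ |ζ.im| < (m' : ℝ)} := by
    intro k m' hmk
    have : V k m' = fun ζ => ∑ i, lam k i • Vt k i m' hmk ζ := by
      funext ζ; simp [hV_def, hmk]
    rw [this]
    refine DifferentiableOn.fun_sum fun i _ => ?_
    have hsub : {ζ : ℂ | |ζ.re| < ε ∧ |ζ.im| < (m' : ℝ)} ⊆ {ζ : ℂ | |ζ.re| < ε ∧ |ζ.im| < (m' : ℝ) + 1} :=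
      fun z hz => ⟨hz.1, hz.2.trans (by linarith)⟩
    exact (differentiableOn_const (lam k i)).smul ((hVd k i m' hmk).mono hsub)
  have hbd : ∀ k m' : ℕ, m' ≤ k → ∀ ζ : ℂ, |ζ.re| < ε → |ζ.im| < (m' : ℝ) →
      ‖V k m' ζ‖ ≤ K * Real.exp (μ * m') := by
    intro k m' hmk ζ h1 h2
    have hV : V k m' ζ = ∑ i, lam k i • Vt k i m' hmk ζ := by simp [hV_def, hmk]
    rw [hV]
    have hterm : ∀ i ∈ Finset.univ, ‖Vt k i m' hmk ζ‖ ≤ Kof m' * Kfix ^ m * Ψ1 :=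
      fun i _ => hVb k i m' hmk ζ h1 (h2.trans (by linarith))
    have hKof0 : 0 ≤ Kof m' := le_max_right _ _
    calc ‖∑ i, lam k i • Vt k i m' hmk ζ‖ ≤ (∑ i, ‖lam k i‖) * (Kof m' * Kfix ^ m * Ψ1) :=
          norm_sum_smul_le_of_le _ _ _ hterm
      _ ≤ max M 0 * (Kof m' * Kfix ^ m * Ψ1) :=
          mul_le_mul_of_nonneg_right ((hlam k).trans (le_max_left _ _)) (by positivity)
      _ ≤ max M 0 * (((4 * |C| * |A| * (δ / 16) ^ (-μ) * Real.exp |μ|) * Real.exp (μ * m')) * Kfix ^ m * Ψ1) := by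
          gcongr
          exact hKof_le m'
      _ = K * Real.exp (μ * m') := by rw [hK_def]; ring
  have hreal : ∀ k m' : ℕ, m' ≤ k → ∀ θ : ℝ, |θ| < ε → V k m' θ = g k θ := by
    intro k m' hmk θ hθ
    have hV : V k m' θ = ∑ i, lam k i • Vt k i m' hmk θ := by simp [hV_def, hmk]
    have hg : g k θ = h.fieldVec (m + 1) (fun _ => ()) (linActMulti (planeRot (0 : Fin 3) θ) (Fk k)) (hrotFk k θ hθ) := by
      simp [hg_def, hθ]
    rw [hV, hg]
    have hsum : IsTimeOrdered (∑ i, lam k i • linActMulti (planeRot (0 : Fin 3) θ) (T k i)) :=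
      isTimeOrdered_finset_sum _ _ _ fun i => hTO k i k le_rfl θ hθ
    rw [fieldVec_congr h (linActMulti_finset_sum_smul Finset.univ (planeRot (0 : Fin 3) θ) (lam k) (T k))
      (hrotFk k θ hθ) hsum, fieldVec_finset_sum h Finset.univ (lam k) _ (fun i => hTO k i k le_rfl θ hθ) hsum]
    exact Finset.sum_congr rfl fun i _ => by rw [hVr k i m' hmk θ hθ (hTO k i k le_rfl θ hθ)]
  have hconv : ∀ θ : ℝ, |θ| < ε → Tendsto (fun k => g k θ) atTop (𝓝 (g' θ)) := by
    intro θ hθ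
    have hg : (fun k => g k θ) = fun k =>
        h.fieldVec (m + 1) (fun _ => ()) (linActMulti (planeRot (0 : Fin 3) θ) (Fk k)) (hrotFk k θ hθ) := by
      funext k; simp [hg_def, hθ]
    have hg' : g' θ = h.fieldVec (m + 1) (fun _ => ()) (linActMulti (planeRot (0 : Fin 3) θ) F) (hrotF θ hθ) := by
      simp [hg'_def, hθ]
    rw [hg, hg']
    have hFk : Tendsto Fk atTop (𝓝 F) := tendsto_schwartz_of_seminorm F Fk fun k p q hp hq => herr k p q hp hq
    have hlim : Tendsto (fun k => linActMulti (planeRot (0 : Fin 3) θ) (Fk k)) atTop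
        (𝓝 (linActMulti (planeRot (0 : Fin 3) θ) F)) :=
      ((linActMulti (planeRot (0 : Fin 3) θ)).continuous.tendsto F).comp hFk
    exact tendsto_fieldVec h (fun k => hrotFk k θ hθ) (hrotF θ hθ) hlim
  -- Step 8: (A1)
  obtain ⟨W, hWd, hWb, hWr⟩ := stub_asmHeightsVitali h.Hilbert ε K μ hε hK0 hμ V g g' hdiff hbd hreal hconv
  refine ⟨ε, hε, W, K * Real.exp μ, hWd, fun θ hθ => hWb θ hθ, fun θ hθ hθ' => ?_⟩
  rw [hWr θ hθ]
  simp [hg'_def, hθ]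

end Summit.QuantumFields.YangMills.Theorems.SoftKernelBoostCovariance.Sketch

end
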